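import Summits.KontsevichZagierPeriods.KontsevichZagierPeriods.Theorems.RootDecompWalshStrataBallChart

/-!
# Ball-cube descent 2/7: pointwise identities along the chart; the chart domains `Ω₁ = Φ⁻¹R₁`, `Ω₂ = Φ⁻¹R₂`

Gen 5 of the decomposition node `WalshStrata` (route `RootDecompWalshStrata`, support item
`QuadricBakerDescent` stmt-KontsevichZagierPeriods-27597, its `d = 3` slice): the first two-variable
`√(quadratic)` weight over CUBE-CUT cells decided inside KZ's rules (1)–(3) over `ℚ` —
`sqrtDescent₂_ball : ∀ γ, SqrtDescent₂ K₇ γ` (part 6) for the ball quadric `P = 7/4 − x² − y² − z²`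
(`D = 7 − 4x² − 4y²`; atoms = the disc `x² + y² < 3/4` and the annulus `3/4 < x² + y² < 7/4` cut by
the faces `x = 1`, `y = 1`, plus null/empty/zero-weight atoms), and the corollary
`ballCube_bakerDescent` (part 7): `(d, P, q) = (3, 7/4 − Σxᵢ², q)` is an instance of
`QuadricBakerDescent` for every `q ∈ ℚ`.  Mechanism: the fibrewise vertex chart
`(v, x) ↦ (x, s(x)·v/(1 + v²))`, `s = √(7 − 4x²)`, makes `√D·|det| = (7 − 4x²)(1 − v²)²/(1 + v²)³`
RATIONAL; Newton–Leibniz in `x` over an arbitrary semialgebraic base (the landed band identity); the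
`√(7 − 4x²)`-CANCELLATION on the algebraic edges `x² = β(v)` (circle) and `x² = α(v)` (face `y = 1`)
under the charts `v₁ = 2p/(s + 2)`, `v₂ = 2/(s + 2p)` (`p = √(3/4 − x²)`) reduces both boundary terms to
`E(x²)·√(3/4 − x²)`, `E ∈ ℚ(X)`, hence to rational integrands by the Euler chart of `x² + y² = 3/4`.
This part: `√D∘Φ`, the edge functions `α(v) = (7v² − (1+v²)²)/(4v²)` (face `y = 1`) and
`β(v) = (3(1+v²)² − 28v²)/(4(1−v²)²)` (circle `x² + y² = 3/4`), the preimage bands `Ω₁`, `Ω₂` over the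
semialgebraic bases `V₁ = {β > 0}`, `(0,1)`, and `chΦ '' Ω₁ = R₁`, `chΦ '' Ω₂ = R₂`.  Imports: part 1;
0 sorry. [KontsevichZagier2001 §1.2; BCR1998 §2.2]
-/

noncomputable section

open Literature.NumberTheory.Transcendental
open MeasureTheory Set
open MvPolynomial (aeval X C)
open Literature.ModelTheory.ExponentialFields (IsSemialgebraic isSemialgebraic_univ
  isSemialgebraic_setOf_eval_pos isSemialgebraic_setOf_eval_lt isSemialgebraic_setOf_eval_le
  isSemialgebraic_setOf_eval_nonneg isSemialgebraic_setOf_eval_eq_zero continuous_aeval_real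
  tarski_seidenberg_real_holds)
open Summit.KontsevichZagierPeriods.RootDecompWalshStrata.WalshSpanProof (isSemialgebraic_cubeSet
  isBounded_cubeSet)
open Summit.KontsevichZagierPeriods.RootDecompWalshStrata.ConeSpecimen (unitIoo isSemialgebraic_unitIoo
  unitIoo_subset_Icc mem_unitIoo)
open Summit.KontsevichZagierPeriods.RootDecompWalshStrata.PointlessOctant (boxTwo isSemialgebraic_boxTwo
  boxTwo_subset_Icc euler_inj)

namespace Summit.KontsevichZagierPeriods.RootDecompWalshStrata.ConicDescent.BallCube

/-! #### 23.4 Pointwise identities along the chart -/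

/-- `Fin.init z 0 = z 0` on `Fin 2` (file-local rfl helper). [folklore] -/
@[simp] private theorem init_apply_zero₂ (z : Fin 2 → ℝ) : Fin.init z 0 = z 0 := rfl

/-- `Fin.last 1 = 1` (file-local rfl helper). [folklore] -/
@[simp] private theorem last_one₂ : (Fin.last 1 : Fin 2) = 1 := rfl

/-- The constant `1` is `ℚ`-semialgebraic on a `ℚ`-semialgebraic set (file-local copy). [BCR1998 §2.2] -/
private theorem isSemialgebraicFunOn_one {N : ℕ} {X : Set (Fin N → ℝ)} (hX : IsSemialgebraic ℚ X) :
    IsSemialgebraicFunOn ℚ X fun _ => (1 : ℝ) :=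
  (isSemialgebraicFunOn_ratCast hX 1).congr fun _ _ => Rat.cast_one

/-- The constant `0` is `ℚ`-semialgebraic on a `ℚ`-semialgebraic set (file-local copy). [BCR1998 §2.2] -/
private theorem isSemialgebraicFunOn_zero {N : ℕ} {X : Set (Fin N → ℝ)} (hX : IsSemialgebraic ℚ X) :
    IsSemialgebraicFunOn ℚ X fun _ => (0 : ℝ) :=
  (isSemialgebraicFunOn_ratCast hX 0).congr fun _ _ => Rat.cast_zero

/-- Lemma `chart_ysq` of the ball-cube descent (gen 5; see the section docstring). [this node] -/
theorem chart_ysq (x v : ℝ) (hx : x ^ 2 ≤ 7 / 4) :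
    (chS x * (v / (1 + v ^ 2))) ^ 2 = (7 - 4 * x ^ 2) * v ^ 2 / (1 + v ^ 2) ^ 2 := by
  rw [mul_pow, div_pow, chS_sq hx]; ring

/-- `D ∘ Φ = s(x)²(1 − v²)²/(1 + v²)²`. -/
theorem chart_D (x v : ℝ) (hx : x ^ 2 ≤ 7 / 4) :
    7 - 4 * x ^ 2 - 4 * (chS x * (v / (1 + v ^ 2))) ^ 2 =
      (7 - 4 * x ^ 2) * (1 - v ^ 2) ^ 2 / (1 + v ^ 2) ^ 2 := by
  rw [chart_ysq x v hx]
  have h : (1 + v ^ 2) ≠ 0 := by positivity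
  field_simp
  ring

/-- `√D ∘ Φ = s(x)(1 − v²)/(1 + v²)` for `v² ≤ 1`. -/
theorem chart_sqrtD (x v : ℝ) (hx : x ^ 2 ≤ 7 / 4) (hv : v ^ 2 ≤ 1) :
    √(7 - 4 * x ^ 2 - 4 * (chS x * (v / (1 + v ^ 2))) ^ 2) =
      chS x * ((1 - v ^ 2) / (1 + v ^ 2)) := by
  rw [chart_D x v hx]
  have h : (7 - 4 * x ^ 2) * (1 - v ^ 2) ^ 2 / (1 + v ^ 2) ^ 2 =
      (chS x * ((1 - v ^ 2) / (1 + v ^ 2))) ^ 2 := by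
    rw [mul_pow, div_pow, chS_sq hx, mul_div_assoc]
  rw [h]
  exact Real.sqrt_sq (mul_nonneg (chS_nonneg x) (div_nonneg (by linarith) (by positivity)))

/-- `x² + y² − 3/4` along the chart. -/
theorem chart_C1 (x v : ℝ) (hx : x ^ 2 ≤ 7 / 4) :
    x ^ 2 + (chS x * (v / (1 + v ^ 2))) ^ 2 - 3 / 4 =
      ((1 - v ^ 2) ^ 2 * x ^ 2 - (3 * (1 + v ^ 2) ^ 2 - 28 * v ^ 2) / 4) / (1 + v ^ 2) ^ 2 := by
  rw [chart_ysq x v hx]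
  have h : (1 + v ^ 2) ≠ 0 := by positivity
  field_simp
  ring

/-- `α(v) = (7v² − (1 + v²)²)/(4v²)`: the face `y = 1` is the curve `x² = α(v)`. -/
def chα (v : ℝ) : ℝ := (7 * v ^ 2 - (1 + v ^ 2) ^ 2) / (4 * v ^ 2)

/-- `β(v) = (3(1 + v²)² − 28v²)/(4(1 − v²)²)`: the circle `x² + y² = 3/4` is the curve
`x² = β(v)`. -/
def chβ (v : ℝ) : ℝ := (3 * (1 + v ^ 2) ^ 2 - 28 * v ^ 2) / (4 * (1 - v ^ 2) ^ 2)

/-- Lemma `chα_lt` of the ball-cube descent (gen 5; see the section docstring). [this node] -/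
theorem chα_lt {v : ℝ} (hv0 : v ≠ 0) (hv1 : v ^ 2 ≠ 1) : chα v < 3 / 4 := by
  have h4 : 0 < 4 * v ^ 2 := by positivity
  have h1 : 0 < (1 - v ^ 2) ^ 2 := lt_of_le_of_ne (sq_nonneg _) (Ne.symm (pow_ne_zero 2 (sub_ne_zero.2 (Ne.symm hv1))))
  rw [chα, div_lt_iff₀ h4]
  nlinarith [h1]

/-- Lemma `chβ_lt` of the ball-cube descent (gen 5; see the section docstring). [this node] -/
theorem chβ_lt {v : ℝ} (hv0 : v ≠ 0) (hv1 : v ^ 2 ≠ 1) : chβ v < 3 / 4 := by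
  have h1 : 0 < (1 - v ^ 2) ^ 2 := lt_of_le_of_ne (sq_nonneg _) (Ne.symm (pow_ne_zero 2 (sub_ne_zero.2 (Ne.symm hv1))))
  have h4 : 0 < 4 * (1 - v ^ 2) ^ 2 := by positivity
  have hv : 0 < v ^ 2 := by positivity
  rw [chβ, div_lt_iff₀ h4]
  nlinarith [h1]

/-- `y < 1 ↔ α(v) < x²` along the chart (`0 < v`, `x² ≤ 7/4`). -/
theorem chart_lt_one_iff {x v : ℝ} (hv0 : 0 < v) (hx : x ^ 2 ≤ 7 / 4) :
    chS x * (v / (1 + v ^ 2)) < 1 ↔ chα v < x ^ 2 := by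
  have hy0 : 0 ≤ chS x * (v / (1 + v ^ 2)) :=
    mul_nonneg (chS_nonneg x) (div_nonneg hv0.le (by positivity))
  rw [← pow_lt_one_iff_of_nonneg hy0 two_ne_zero, chart_ysq x v hx, div_lt_one (by positivity), chα,
    div_lt_iff₀ (by positivity)]
  constructor <;> intro h <;> nlinarith [h]

/-- `3/4 < x² + y² ↔ β(v) < x²` along the chart (`v² < 1`). -/
theorem chart_gt34_iff {x v : ℝ} (hv1 : v ^ 2 < 1) (hx : x ^ 2 ≤ 7 / 4) :
    3 / 4 < x ^ 2 + (chS x * (v / (1 + v ^ 2))) ^ 2 ↔ chβ v < x ^ 2 := by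
  have hC := chart_C1 x v hx
  have h4 : 0 < 4 * (1 - v ^ 2) ^ 2 := mul_pos four_pos (pow_pos (by linarith) 2)
  rw [← sub_pos, hC, div_pos_iff_of_pos_right (by positivity), sub_pos, chβ, div_lt_iff₀ h4]
  constructor <;> intro h <;> linarith

/-- `x² + y² < 3/4 ↔ x² < β(v)` along the chart (`v² < 1`). -/
theorem chart_lt34_iff {x v : ℝ} (hv1 : v ^ 2 < 1) (hx : x ^ 2 ≤ 7 / 4) :
    x ^ 2 + (chS x * (v / (1 + v ^ 2))) ^ 2 < 3 / 4 ↔ x ^ 2 < chβ v := by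
  have hC := chart_C1 x v hx
  have h4 : 0 < 4 * (1 - v ^ 2) ^ 2 := mul_pos four_pos (pow_pos (by linarith) 2)
  rw [← sub_neg, hC, div_lt_iff₀ (by positivity : (0:ℝ) < (1 + v ^ 2) ^ 2), zero_mul, sub_neg, chβ,
    lt_div_iff₀ h4]
  constructor <;> intro h <;> linarith

/-- `x² + y² < 7/4` along the chart (`v² < 1`, `x² < 7/4`). -/
theorem chart_lt74 {x v : ℝ} (hv1 : v ^ 2 < 1) (hx : x ^ 2 < 7 / 4) :
    x ^ 2 + (chS x * (v / (1 + v ^ 2))) ^ 2 < 7 / 4 := by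
  have h := chart_D x v hx.le
  have hpos : 0 < (7 - 4 * x ^ 2) * (1 - v ^ 2) ^ 2 / (1 + v ^ 2) ^ 2 :=
    div_pos (mul_pos (by linarith) (pow_pos (by linarith) 2)) (by positivity)
  linarith

/-- Fibrewise inverse of the chart: every `y > 0` with `D(x, y) > 0` is `s(x)·v/(1 + v²)` for some
`v ∈ (0,1)` (namely `v = (s − √D)/(2y)`). -/
theorem chart_inv {x y : ℝ} (hy : 0 < y) (hD : 0 < 7 - 4 * x ^ 2 - 4 * y ^ 2) :
    ∃ v : ℝ, 0 < v ∧ v < 1 ∧ chS x * (v / (1 + v ^ 2)) = y := by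
  have hx : x ^ 2 ≤ 7 / 4 := by nlinarith [sq_nonneg y]
  have hs2 : chS x ^ 2 = 7 - 4 * x ^ 2 := chS_sq hx
  have hs0 : 0 ≤ chS x := chS_nonneg x
  set s := chS x with hs_def
  set d := √(7 - 4 * x ^ 2 - 4 * y ^ 2) with hd_def
  have hd2 : d ^ 2 = 7 - 4 * x ^ 2 - 4 * y ^ 2 := Real.sq_sqrt hD.le
  have hd0 : 0 < d := Real.sqrt_pos.2 hD
  have hds : d < s := by
    by_contra h
    push Not at h
    nlinarith [mul_le_mul h h hs0 hd0.le]
  have hs_pos : 0 < s := hd0.trans hds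
  have hsd0 : 0 < s + d := by linarith
  have h2y : 2 * y < s := by
    by_contra h
    push Not at h
    nlinarith [mul_le_mul h h hs0 (by linarith)]
  refine ⟨(s - d) / (2 * y), div_pos (by linarith) (by linarith), ?_, ?_⟩
  · rw [div_lt_one (by linarith)]
    nlinarith [mul_pos hy (show 0 < s + d - 2 * y by linarith)]
  · have hy2 : (2 * y) ≠ 0 := by positivity
    have hq : 1 + ((s - d) / (2 * y)) ^ 2 = (4 * y ^ 2 + (s - d) ^ 2) / (2 * y) ^ 2 := by
      field_simp
      ring
    have hnum : 0 < 4 * y ^ 2 + (s - d) ^ 2 := by positivity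
    have e : (s - d) / (2 * y) * (2 * y) ^ 2 = (s - d) * (2 * y) := by
      field_simp
    rw [hq, div_div_eq_mul_div, ← mul_div_assoc, div_eq_iff hnum.ne', e]
    linear_combination y * hs2 - y * hd2

/-! #### 23.5 The chart domains `Ω₁ = Φ⁻¹ R₁`, `Ω₂ = Φ⁻¹ R₂` -/

/-- The edge function `chα` (composed with the first coordinate) is `ℚ`-semialgebraic on `unitIoo`. -/
theorem isSemialgebraicFunOn_chα : IsSemialgebraicFunOn ℚ unitIoo fun w => chα (w 0) :=
  (isSemialgebraicFunOn_aeval_div_aeval isSemialgebraic_unitIoo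
      (7 * X 0 ^ 2 - (1 + X 0 ^ 2) ^ 2) (4 * X 0 ^ 2) fun w hw => by
        have h : 0 < w 0 := (mem_unitIoo.1 hw).1
        have h4 : (0:ℝ) < 4 * w 0 ^ 2 := by positivity
        simpa using h4.ne').congr fun w _ => by
    simp [chα]

/-- Lemma `isSemialgebraicFunOn_chβ` of the ball-cube descent (gen 5; see the section docstring). [this node] -/
theorem isSemialgebraicFunOn_chβ : IsSemialgebraicFunOn ℚ unitIoo fun w => chβ (w 0) :=
  (isSemialgebraicFunOn_aeval_div_aeval isSemialgebraic_unitIoo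
      (3 * (1 + X 0 ^ 2) ^ 2 - 28 * X 0 ^ 2) (4 * (1 - X 0 ^ 2) ^ 2) fun w hw => by
        obtain ⟨h0, h1⟩ := mem_unitIoo.1 hw
        have h2 : 0 < 1 - w 0 ^ 2 := by nlinarith
        have h4 : (0:ℝ) < 4 * (1 - w 0 ^ 2) ^ 2 := by positivity
        simpa using h4.ne').congr fun w _ => by
    simp [chβ]

/-- `V₁ = {v ∈ (0,1) | β(v) > 0}` (`= (0, (√7 − 2)/√3)`), base of `Ω₁`. -/
def V₁ : Set (Fin 1 → ℝ) := {w | w ∈ unitIoo ∧ 0 < chβ (w 0)}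

/-- `V₃ = {v ∈ (0,1) | α(v) > 0}` (`= ((√7 − √3)/2, 1)`). -/
def V₃ : Set (Fin 1 → ℝ) := {w | w ∈ unitIoo ∧ 0 < chα (w 0)}

/-- Lemma `isSemialgebraic_V₁` of the ball-cube descent (gen 5; see the section docstring). [this node] -/
theorem isSemialgebraic_V₁ : IsSemialgebraic ℚ V₁ :=
  IsSemialgebraicFunOn.isSemialgebraic_sep_pos isSemialgebraicFunOn_chβ

/-- Lemma `isSemialgebraic_V₃` of the ball-cube descent (gen 5; see the section docstring). [this node] -/
theorem isSemialgebraic_V₃ : IsSemialgebraic ℚ V₃ :=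
  IsSemialgebraicFunOn.isSemialgebraic_sep_pos isSemialgebraicFunOn_chα

/-- Lemma `V₁_subset` of the ball-cube descent (gen 5; see the section docstring). [this node] -/
theorem V₁_subset : V₁ ⊆ unitIoo := fun _ hw => hw.1

/-- Lemma `V₃_subset` of the ball-cube descent (gen 5; see the section docstring). [this node] -/
theorem V₃_subset : V₃ ⊆ unitIoo := fun _ hw => hw.1

/-- Lemma `mem_V₁` of the ball-cube descent (gen 5; see the section docstring). [this node] -/
theorem mem_V₁ {w : Fin 1 → ℝ} : w ∈ V₁ ↔ (0 < w 0 ∧ w 0 < 1) ∧ 0 < chβ (w 0) := by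
  simp only [V₁, mem_setOf_eq, mem_unitIoo]

/-- Lemma `mem_V₃` of the ball-cube descent (gen 5; see the section docstring). [this node] -/
theorem mem_V₃ {w : Fin 1 → ℝ} : w ∈ V₃ ↔ (0 < w 0 ∧ w 0 < 1) ∧ 0 < chα (w 0) := by
  simp only [V₃, mem_setOf_eq, mem_unitIoo]

/-- `Ω₁ = {(v, x) | v ∈ V₁, 0 < x < √β(v)}`. -/
def Ω₁ : Set (Fin 2 → ℝ) := oband V₁ (fun _ => 0) fun w => √(chβ (w 0))

/-- `Ω₂ = {(v, x) | v ∈ (0,1), √(max α β)(v) < x < 1}`. -/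
def Ω₂ : Set (Fin 2 → ℝ) := oband unitIoo (fun w => √(max (chα (w 0)) (chβ (w 0)))) fun _ => 1

/-- Lemma `mem_Ω₁` of the ball-cube descent (gen 5; see the section docstring). [this node] -/
theorem mem_Ω₁ {z : Fin 2 → ℝ} :
    z ∈ Ω₁ ↔ ((0 < z 0 ∧ z 0 < 1) ∧ 0 < chβ (z 0)) ∧ 0 < z 1 ∧ z 1 ^ 2 < chβ (z 0) := by
  simp only [Ω₁, mem_oband, mem_V₁, init_apply_zero₂, last_one₂]
  constructor
  · rintro ⟨hv, h1, h2⟩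
    exact ⟨hv, h1, (Real.lt_sqrt h1.le).1 h2⟩
  · rintro ⟨hv, h1, h2⟩
    exact ⟨hv, h1, (Real.lt_sqrt h1.le).2 h2⟩

/-- Lemma `mem_Ω₂` of the ball-cube descent (gen 5; see the section docstring). [this node] -/
theorem mem_Ω₂ {z : Fin 2 → ℝ} :
    z ∈ Ω₂ ↔ (0 < z 0 ∧ z 0 < 1) ∧ (0 < z 1 ∧ z 1 < 1) ∧ chα (z 0) < z 1 ^ 2 ∧ chβ (z 0) < z 1 ^ 2 := by
  simp only [Ω₂, mem_oband, mem_unitIoo, init_apply_zero₂, last_one₂]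
  constructor
  · rintro ⟨hv, h1, h2⟩
    have hx0 : 0 < z 1 := (Real.sqrt_nonneg _).trans_lt h1
    have h := (Real.sqrt_lt' hx0).1 h1
    exact ⟨hv, ⟨hx0, h2⟩, (max_lt_iff.1 h).1, (max_lt_iff.1 h).2⟩
  · rintro ⟨hv, ⟨hx0, hx1⟩, ha, hb⟩
    exact ⟨hv, (Real.sqrt_lt' hx0).2 (max_lt ha hb), hx1⟩

/-- Lemma `Ω₁_subset_boxTwo` of the ball-cube descent (gen 5; see the section docstring). [this node] -/
theorem Ω₁_subset_boxTwo : Ω₁ ⊆ boxTwo := by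
  intro z hz
  obtain ⟨⟨⟨hv0, hv1⟩, hβ⟩, hx0, hxβ⟩ := mem_Ω₁.1 hz
  have hβlt : chβ (z 0) < 3 / 4 := chβ_lt hv0.ne' (by nlinarith)
  have hx1 : z 1 < 1 := by nlinarith
  intro j
  fin_cases j
  · exact ⟨hv0, hv1⟩
  · exact ⟨hx0, hx1⟩

/-- Lemma `Ω₂_subset_boxTwo` of the ball-cube descent (gen 5; see the section docstring). [this node] -/
theorem Ω₂_subset_boxTwo : Ω₂ ⊆ boxTwo := by
  intro z hz
  obtain ⟨⟨hv0, hv1⟩, ⟨hx0, hx1⟩, -, -⟩ := mem_Ω₂.1 hz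
  intro j
  fin_cases j
  · exact ⟨hv0, hv1⟩
  · exact ⟨hx0, hx1⟩

/-- Lemma `isSemialgebraic_Ω₁` of the ball-cube descent (gen 5; see the section docstring). [this node] -/
theorem isSemialgebraic_Ω₁ : IsSemialgebraic ℚ Ω₁ :=
  isSemialgebraic_oband (isSemialgebraicFunOn_zero isSemialgebraic_V₁)
    (IsSemialgebraicFunOn.sqrt_holds (isSemialgebraicFunOn_chβ.mono V₁_subset isSemialgebraic_V₁))

/-- Lemma `isSemialgebraicFunOn_maxαβ` of the ball-cube descent (gen 5; see the section docstring). [this node] -/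
theorem isSemialgebraicFunOn_maxαβ :
    IsSemialgebraicFunOn ℚ unitIoo fun w => max (chα (w 0)) (chβ (w 0)) := by
  have h := IsSemialgebraicFunOn.add_holds (IsSemialgebraicFunOn.add_holds isSemialgebraicFunOn_chα
    isSemialgebraicFunOn_chβ) (IsSemialgebraicFunOn.sub_holds isSemialgebraicFunOn_chα
    isSemialgebraicFunOn_chβ).abs
  refine ((isSemialgebraicFunOn_ratCast isSemialgebraic_unitIoo (1 / 2)).mul_holds h).congr
    fun w _ => ?_
  simp only [Pi.mul_apply, Pi.add_apply, Pi.sub_apply]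
  rw [max_def]
  split_ifs with hle
  · rw [abs_of_nonpos (by linarith)]; push_cast; ring
  · rw [abs_of_pos (by linarith)]; push_cast; ring

/-- Lemma `isSemialgebraic_Ω₂` of the ball-cube descent (gen 5; see the section docstring). [this node] -/
theorem isSemialgebraic_Ω₂ : IsSemialgebraic ℚ Ω₂ :=
  isSemialgebraic_oband (IsSemialgebraicFunOn.sqrt_holds isSemialgebraicFunOn_maxαβ)
    (isSemialgebraicFunOn_one isSemialgebraic_unitIoo)

/-- `Φ(Ω₁) = R₁`. -/
theorem image_chΦ_Ω₁ : chΦ '' Ω₁ = R₁ := by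
  ext u
  constructor
  · rintro ⟨z, hz, rfl⟩
    obtain ⟨⟨⟨hv0, hv1⟩, hβ⟩, hx0, hxβ⟩ := mem_Ω₁.1 hz
    have hv2 : z 0 ^ 2 < 1 := by nlinarith
    have hβlt : chβ (z 0) < 3 / 4 := chβ_lt hv0.ne' hv2.ne
    have hx74 : z 1 ^ 2 ≤ 7 / 4 := by linarith
    have hs : 0 < chS (z 1) := chS_pos (by linarith)
    have hy0 : 0 < chS (z 1) * (z 0 / (1 + z 0 ^ 2)) := mul_pos hs (div_pos hv0 (by positivity))
    have hsum : z 1 ^ 2 + (chS (z 1) * (z 0 / (1 + z 0 ^ 2))) ^ 2 < 3 / 4 :=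
      (chart_lt34_iff hv2 hx74).2 hxβ
    have hy1 : chS (z 1) * (z 0 / (1 + z 0 ^ 2)) < 1 := by nlinarith
    have hx1 : z 1 < 1 := by nlinarith
    refine ⟨fun j => ?_, ?_⟩
    · fin_cases j
      · exact ⟨by simpa using hx0, by simpa using hx1⟩
      · exact ⟨by simpa using hy0, by simpa using hy1⟩
    · simpa using hsum
  · rintro ⟨hu, hsum⟩
    have hu0 := hu 0; have hu1 := hu 1
    have hD : 0 < 7 - 4 * u 0 ^ 2 - 4 * u 1 ^ 2 := by linarith
    obtain ⟨v, hv0, hv1, hvy⟩ := chart_inv hu1.1 hD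
    have hv2 : v ^ 2 < 1 := by nlinarith
    have hx74 : u 0 ^ 2 ≤ 7 / 4 := by nlinarith
    have hsum' : u 0 ^ 2 + (chS (u 0) * (v / (1 + v ^ 2))) ^ 2 < 3 / 4 := by rw [hvy]; exact hsum
    have hxβ : u 0 ^ 2 < chβ v := (chart_lt34_iff hv2 hx74).1 hsum'
    have hβ : 0 < chβ v := lt_of_le_of_lt (sq_nonneg _) hxβ
    refine ⟨![v, u 0], mem_Ω₁.2 ⟨⟨⟨by simpa using hv0, by simpa using hv1⟩, by simpa using hβ⟩,
      by simpa using hu0.1, by simpa using hxβ⟩, ?_⟩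
    funext j
    fin_cases j
    · simp
    · simp [hvy]

/-- `Φ(Ω₂) = R₂`. -/
theorem image_chΦ_Ω₂ : chΦ '' Ω₂ = R₂ := by
  ext u
  constructor
  · rintro ⟨z, hz, rfl⟩
    obtain ⟨⟨hv0, hv1⟩, ⟨hx0, hx1⟩, hα, hβ⟩ := mem_Ω₂.1 hz
    have hv2 : z 0 ^ 2 < 1 := by nlinarith
    have hx74' : z 1 ^ 2 < 7 / 4 := by nlinarith
    have hx74 : z 1 ^ 2 ≤ 7 / 4 := hx74'.le
    have hs : 0 < chS (z 1) := chS_pos hx74'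
    have hy0 : 0 < chS (z 1) * (z 0 / (1 + z 0 ^ 2)) := mul_pos hs (div_pos hv0 (by positivity))
    have hy1 : chS (z 1) * (z 0 / (1 + z 0 ^ 2)) < 1 := (chart_lt_one_iff hv0 hx74).2 hα
    have hgt : 3 / 4 < z 1 ^ 2 + (chS (z 1) * (z 0 / (1 + z 0 ^ 2))) ^ 2 :=
      (chart_gt34_iff hv2 hx74).2 hβ
    have hlt : z 1 ^ 2 + (chS (z 1) * (z 0 / (1 + z 0 ^ 2))) ^ 2 < 7 / 4 := chart_lt74 hv2 hx74'
    refine ⟨fun j => ?_, ?_, ?_⟩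
    · fin_cases j
      · exact ⟨by simpa using hx0, by simpa using hx1⟩
      · exact ⟨by simpa using hy0, by simpa using hy1⟩
    · simpa using hgt
    · simpa using hlt
  · rintro ⟨hu, hgt, hlt⟩
    have hu0 := hu 0; have hu1 := hu 1
    have hD : 0 < 7 - 4 * u 0 ^ 2 - 4 * u 1 ^ 2 := by linarith
    obtain ⟨v, hv0, hv1, hvy⟩ := chart_inv hu1.1 hD
    have hv2 : v ^ 2 < 1 := by nlinarith
    have hx74 : u 0 ^ 2 ≤ 7 / 4 := by nlinarith
    have hα : chα v < u 0 ^ 2 := (chart_lt_one_iff hv0 hx74).1 (by rw [hvy]; exact hu1.2)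
    have hβ : chβ v < u 0 ^ 2 := (chart_gt34_iff hv2 hx74).1 (by rw [hvy]; exact hgt)
    refine ⟨![v, u 0], mem_Ω₂.2 ⟨⟨by simpa using hv0, by simpa using hv1⟩,
      ⟨by simpa using hu0.1, by simpa using hu0.2⟩, by simpa using hα, by simpa using hβ⟩, ?_⟩
    funext j
    fin_cases j
    · simp
    · simp [hvy]

end Summit.KontsevichZagierPeriods.RootDecompWalshStrata.ConicDescent.BallCube

end
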